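import Summits.Ventures.CertifiedManyBodySolver.Observables.StiffnessApexTransportFanTwoSided
import HarnessLib

/-!
# Ventures/CertifiedManyBodySolver — Observables/StiffnessApexTransportFanSlotTwoSided.lean

HONEST FRAMING: one-sided certified CEILINGS on the uniform flux stiffness (t–t′ f-sum class) at half filling, TRANSPORTED from ONE solved
source point whose certificate was read at an ARBITRARY hopping slot `σ` (e.g. the CORNER-OBJECTIVE rows of the curtain plan) to BOTH sides
of its apex curve; conditional on the source rows named (slot-`σ` orbit row + `K₂` ceiling on the source class); the target side uses the
KINEMATIC `K₂` ceiling `1.6211390` (or a named one); a ceiling never speaks to the presence of order; not a `T_c` estimate, not a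
superconductivity verdict; no phase sentence. Zero compute, no definition, no claim node, no `sorry`.

Cell `pub/hubbard-downfold` (D-0150 L-DF2 «box ↦ one word»), seat `hubbard-downfold-unc-2` (`prover-hubbard-downfold-unc-2-g16-0`); the slot-`σ`
edition of `Observables/StiffnessApexTransportFanTwoSided.lean` (own row `σ = t′_A`), and the two-sided edition of §4 of
`Observables/StiffnessApexTransportFan.lean` (slot fan, right of the curve only).

THE SLOT TWO-SIDED FAN. Source class `(t′_A, U_A, 1)`, `t′_A < 0`, carrying a row `r ≤ |D₄|⁻¹Σ Re ω(−X₀(σ))` (`= ¼e_{Φ(1,2σ,0)}`) and `K₂ ≤ A`;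
target `(t′_P, U_P)`, `U_A < U_P`, `t′_P < 0`, with `K₂ ≤ A_P` on its class; `κ = (U_P t′_A − U_A t′_P)/(U_P − U_A)`:
`c ≥ −r + max(2σ − κ, 0)·A/4 + max(κ − 2t′_P, 0)·A_P/4`. On a rectangle `[t₁,t₂] × [U₁,U₂]` (`t′_A ≤ t₁`, `t₂ < 0`, `U_A < U₁`) the hinges peak at
`(t₂, U₁)` and `(t₁, U₂)` ⇒ one decidable inequality (kinematic `A_P`).

References: T. Koma, H. Tasaki, J. Stat. Phys. 76 (1994) 745, §1 [KomaTasaki1994]; D. J. Scalapino, S. R. White, S.-C. Zhang, PRB 47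
(1993) 7995, §II [ScalapinoWhiteZhang1993]; E. H. Lieb, M. Loss, *Analysis* (AMS 2001, 2nd ed.) §8, Theorem 8.2 [LiebLoss1993].
-/

noncomputable section

namespace Summit.Ventures.CertifiedManyBodySolver.Observables

open Literature.MathematicalPhysics.QuantumLattice
open Literature.MathematicalPhysics.QuantumLattice.ThermodynamicLimit
open Literature.MathematicalPhysics.QuantumFieldTheory
open Literature.Probability.LatticeModels
open Matrix Finset Filter Topology HubbardWave0
open scoped Matrix BigOperators ComplexOrder

section SlotTwoSided

variable {t'A UA σ : ℝ}

/-- **THE SLOT TWO-SIDED FAN (half filling, `t′_A < 0`).** A certified orbit row `r` for `−X₀(σ)` on the class at `(t′_A, U_A, 1)` (`U_A ≥ 0`, cap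
certified), a ceiling `K₂ ≤ A` (`A ≥ 0`) there and a ceiling `K₂ ≤ A_P` (`A_P ≥ 0`) on the target class `(t′_P, U_P, 1)` give, for EVERY target with
`U_A < U_P`, `t′_P < 0`, `ObsStiffnessSeqCeilingAt t′_P U_P 1 c` for every `c ≥ −r + max(2σ − κ, 0)·A/4 + max(κ − 2t′_P, 0)·A_P/4`.
[cite: KomaTasaki1994, §1] [cite: ScalapinoWhiteZhang1993, §II] -/
theorem ObsStiffnessSeqCeilingAt_halfFilling_on_apexTwoSidedFan_of_slotRow (Uo : ℝ) (hUA : 0 ≤ UA) (ht'A : t'A < 0) {u r : ℚ}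
    (hrow : SquareTTPrimeCorrOrbitLowerRow t'A UA 1 u r Finset.univ (box 2 7) (-oddMomentObsTT σ Uo 0))
    (hu : energyDensityTT' 1 t'A UA 1 ≤ ((u : ℚ) : ℝ)) {A : ℝ} (hA0 : 0 ≤ A)
    (hA : ∀ (ω : InfVolFermionState 2) (Ls : ℕ → ℕ) (ψ : ∀ L, Fock (Orb (FermionTorus 2 L))),
      Tendsto Ls atTop atTop →
      (∀ j, IsGroundStateInSector (hubbardTorusTT' (Ls j) 1 t'A UA) (rectN 1 (Ls j)) 0 (ψ (Ls j))) →
      (∀ j, star (ψ (Ls j)) ⬝ᵥ ψ (Ls j) = 1) → ω.IsTorusLimitOf ψ Ls →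
      ω.meanEnergy (hubbardTTPrimeFermionInteraction 0 1 0) 1 ≤ A)
    {t'P UP : ℝ} {AP : ℝ} (hAP0 : 0 ≤ AP)
    (hAP : ∀ (ω : InfVolFermionState 2) (Ls : ℕ → ℕ) (ψ : ∀ L, Fock (Orb (FermionTorus 2 L))),
      Tendsto Ls atTop atTop →
      (∀ j, IsGroundStateInSector (hubbardTorusTT' (Ls j) 1 t'P UP) (rectN 1 (Ls j)) 0 (ψ (Ls j))) →
      (∀ j, star (ψ (Ls j)) ⬝ᵥ ψ (Ls j) = 1) → ω.IsTorusLimitOf ψ Ls →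
      ω.meanEnergy (hubbardTTPrimeFermionInteraction 0 1 0) 1 ≤ AP)
    (hU : UA < UP) (ht'P : t'P < 0) (c : ℚ)
    (hc : -((r : ℚ) : ℝ) + max (2 * σ - (UP * t'A - UA * t'P) / (UP - UA)) 0 * A / 4 +
      max ((UP * t'A - UA * t'P) / (UP - UA) - 2 * t'P) 0 * AP / 4 ≤ ((c : ℚ) : ℝ)) :
    ObsStiffnessSeqCeilingAt t'P UP 1 c := by
  have hd : 0 < UP - UA := sub_pos.2 hU
  set κ : ℝ := (UP * t'A - UA * t'P) / (UP - UA) with hκ_def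
  intro ρs θ₀ _ hθ₀ Ls hLs hst
  refine (fluxStiffness_le_of_torusLimitTT'_oddMoment_orbit_certificate_seq t'P (U := UP) (δ := 1 - 1) (q := ((c : ℚ) : ℝ)) 0
    Finset.univ Finset.univ_nonempty (by norm_num) (by norm_num) hθ₀ hLs hst ?_)
  intro ω Ms ψ hMs hψ h1 hω
  have hψ' : ∀ j, IsGroundStateInSector (hubbardTorusTT' (Ms j) 1 t'P UP) (rectN 1 (Ms j)) 0 (ψ (Ms j)) := fun j => by
    simpa only [sub_sub_cancel] using hψ j
  rw [orbitMean_rotOddMomentLimitFunctionalTT_lam_zero_eq_meanEnergy_twice_tPrime hω.isTranslationInvariant]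
  obtain ⟨ψA, φ, ωA, hφ, hψA, hψA1, hωA, -, -, -⟩ :=
    exists_isTorusLimitOf_sectorGroundState_TT' 1 t'A UA zero_le_one one_le_two (Ls := id) tendsto_id
  have hLφ : Tendsto (id ∘ φ : ℕ → ℕ) atTop atTop := tendsto_id.comp hφ.tendsto_atTop
  -- apex row
  have hapx := InfVolFermionState.IsTorusLimitOf.meanEnergy_apexHopping_le_of_groundStates 1 t'A t'P hUA hU zero_le_one
    one_lt_two hωA hLφ (fun j => hψA _) (fun j => hψA1 _) hω hMs hψ' h1
  simp only [← hκ_def] at hapx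
  -- target end, hinge form
  have htgt : ω.meanEnergy (hubbardTTPrimeFermionInteraction 1 κ 0) 1 ≤
      ω.meanEnergy (hubbardTTPrimeFermionInteraction 1 (2 * t'P) 0) 1 + max (κ - 2 * t'P) 0 * AP := by
    rcases le_total κ (2 * t'P) with hle | hge
    · have hcP : 0 ≤ (κ - 2 * t'P) / t'P := div_nonneg_of_nonpos (by linarith) ht'P.le
      have heP : κ - 2 * t'P = (κ - 2 * t'P) / t'P * t'P := by rw [div_mul_cancel₀ _ ht'P.ne]
      have h := InfVolFermionState.IsTorusLimitOf.meanEnergy_oneBody_anti_hopping_of_groundState_halfFilling 1 t'P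
        (hUA.trans hU.le) hω hMs hψ' h1 (κ := 2 * t'P) (κ' := κ) hcP heP
      nlinarith [mul_nonneg (le_max_right (κ - 2 * t'P) 0) hAP0]
    · have h := InfVolFermionState.meanEnergy_hopping_le_add_mul_of_diagHop_le ω 1 (κ := 2 * t'P) (κ' := κ) hge
        (hAP ω Ms ψ hMs hψ' h1 hω)
      have hm : (κ - 2 * t'P) * AP ≤ max (κ - 2 * t'P) 0 * AP := mul_le_mul_of_nonneg_right (le_max_left _ _) hAP0
      linarith
  -- source end at the slot `σ`, hinge form: `e_{2σ}(ω_A) ≤ e_κ(ω_A) + max(2σ − κ, 0)·A`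
  have hsrc : ωA.meanEnergy (hubbardTTPrimeFermionInteraction 1 (2 * σ) 0) 1 ≤
      ωA.meanEnergy (hubbardTTPrimeFermionInteraction 1 κ 0) 1 + max (2 * σ - κ) 0 * A := by
    rcases le_total κ (2 * σ) with hle | hge
    · have h := InfVolFermionState.meanEnergy_hopping_le_add_mul_of_diagHop_le ωA 1 (κ := κ) (κ' := 2 * σ) hle
        (hA ωA (id ∘ φ) ψA hLφ (fun j => hψA _) (fun j => hψA1 _) hωA)
      have hm : (2 * σ - κ) * A ≤ max (2 * σ - κ) 0 * A := mul_le_mul_of_nonneg_right (le_max_left _ _) hA0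
      linarith
    · have hcA : 0 ≤ (2 * σ - κ) / t'A := div_nonneg_of_nonpos (by linarith) ht'A.le
      have heA : 2 * σ - κ = (2 * σ - κ) / t'A * t'A := by rw [div_mul_cancel₀ _ ht'A.ne]
      have h := InfVolFermionState.IsTorusLimitOf.meanEnergy_oneBody_anti_hopping_of_groundState_halfFilling 1 t'A hUA hωA
        hLφ (fun j => hψA _) (fun j => hψA1 _) (κ := κ) (κ' := 2 * σ) hcA heA
      nlinarith [mul_nonneg (le_max_right (2 * σ - κ) 0) hA0]
  have hv := hrow ωA (id ∘ φ) ψA hLφ (fun j => hψA _) (fun j => hψA1 _) hωA hu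
  rw [orbitMean_re_expect_neg_oddMomentTT_lam_zero hωA.isTranslationInvariant] at hv
  linarith

/-- **Slot two-sided fan, KINEMATIC target ceiling** (`A_P = 1.6211390`). [cite: KomaTasaki1994, §1] [cite: LiebLoss1993, §8, Theorem 8.2] -/
theorem ObsStiffnessSeqCeilingAt_halfFilling_on_apexTwoSidedFan_of_slotRow_kinematicTarget (Uo : ℝ) (hUA : 0 ≤ UA) (ht'A : t'A < 0)
    {u r : ℚ} (hrow : SquareTTPrimeCorrOrbitLowerRow t'A UA 1 u r Finset.univ (box 2 7) (-oddMomentObsTT σ Uo 0))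
    (hu : energyDensityTT' 1 t'A UA 1 ≤ ((u : ℚ) : ℝ)) {A : ℝ} (hA0 : 0 ≤ A)
    (hA : ∀ (ω : InfVolFermionState 2) (Ls : ℕ → ℕ) (ψ : ∀ L, Fock (Orb (FermionTorus 2 L))),
      Tendsto Ls atTop atTop →
      (∀ j, IsGroundStateInSector (hubbardTorusTT' (Ls j) 1 t'A UA) (rectN 1 (Ls j)) 0 (ψ (Ls j))) →
      (∀ j, star (ψ (Ls j)) ⬝ᵥ ψ (Ls j) = 1) → ω.IsTorusLimitOf ψ Ls →
      ω.meanEnergy (hubbardTTPrimeFermionInteraction 0 1 0) 1 ≤ A)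
    {t'P UP : ℝ} (hU : UA < UP) (ht'P : t'P < 0) (c : ℚ)
    (hc : -((r : ℚ) : ℝ) + max (2 * σ - (UP * t'A - UA * t'P) / (UP - UA)) 0 * A / 4 +
      max ((UP * t'A - UA * t'P) / (UP - UA) - 2 * t'P) 0 * 1.6211390 / 4 ≤ ((c : ℚ) : ℝ)) :
    ObsStiffnessSeqCeilingAt t'P UP 1 c :=
  ObsStiffnessSeqCeilingAt_halfFilling_on_apexTwoSidedFan_of_slotRow Uo hUA ht'A hrow hu hA0 hA (by norm_num)
    (forall_torusLimit_diagHop_le_kinematic t'P UP zero_le_one one_lt_two) hU ht'P c hc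

/-- **ONE SLOT-READ POINT WORDS A RECTANGLE by one decidable inequality** (half filling, `t′_A < 0`; decimal words `−r ≤ w`, `A ≤ a`; kinematic
target ceiling): for `[t₁, t₂] × [U₁, U₂]` with `t′_A ≤ t₁`, `t₂ < 0`, `U_A < U₁` and
`c ≥ w + max(2σ − κ(t₂, U₁), 0)·a/4 + max(κ(t₁, U₂) − 2t₁, 0)·1.6211390/4`, `ObsStiffnessSeqCeilingAt tp U 1 c` on the rectangle.
[cite: KomaTasaki1994, §1] [cite: ScalapinoWhiteZhang1993, §II] -/
theorem ObsStiffnessSeqCeilingAt_halfFilling_on_rect_of_slotRow_kinematicTarget (Uo : ℝ) (hUA : 0 ≤ UA) (ht'A : t'A < 0) {u r : ℚ}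
    (hrow : SquareTTPrimeCorrOrbitLowerRow t'A UA 1 u r Finset.univ (box 2 7) (-oddMomentObsTT σ Uo 0))
    (hu : energyDensityTT' 1 t'A UA 1 ≤ ((u : ℚ) : ℝ)) {A : ℝ} (hA0 : 0 ≤ A)
    (hA : ∀ (ω : InfVolFermionState 2) (Ls : ℕ → ℕ) (ψ : ∀ L, Fock (Orb (FermionTorus 2 L))),
      Tendsto Ls atTop atTop →
      (∀ j, IsGroundStateInSector (hubbardTorusTT' (Ls j) 1 t'A UA) (rectN 1 (Ls j)) 0 (ψ (Ls j))) →
      (∀ j, star (ψ (Ls j)) ⬝ᵥ ψ (Ls j) = 1) → ω.IsTorusLimitOf ψ Ls →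
      ω.meanEnergy (hubbardTTPrimeFermionInteraction 0 1 0) 1 ≤ A)
    {w a : ℝ} (hw : -((r : ℚ) : ℝ) ≤ w) (ha : A ≤ a) {t₁ t₂ U₁ U₂ : ℝ} (ht₁ : t'A ≤ t₁) (ht₂ : t₂ < 0) (hU₁ : UA < U₁) (c : ℚ)
    (hc : w + max (2 * σ - (U₁ * t'A - UA * t₂) / (U₁ - UA)) 0 * a / 4 +
      max ((U₂ * t'A - UA * t₁) / (U₂ - UA) - 2 * t₁) 0 * 1.6211390 / 4 ≤ ((c : ℚ) : ℝ)) :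
    ∀ tp ∈ Set.Icc t₁ t₂, ∀ U ∈ Set.Icc U₁ U₂, ObsStiffnessSeqCeilingAt tp U 1 c := by
  intro tp htp U hU
  have ha0 : 0 ≤ a := hA0.trans ha
  refine ObsStiffnessSeqCeilingAt_halfFilling_on_apexTwoSidedFan_of_slotRow_kinematicTarget Uo hUA ht'A hrow hu hA0 hA
    (by linarith [hU.1]) (by linarith [htp.2]) c ?_
  have h₁ : max (2 * σ - (U * t'A - UA * tp) / (U - UA)) 0 ≤ max (2 * σ - (U₁ * t'A - UA * t₂) / (U₁ - UA)) 0 :=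
    max_le_max (by linarith [apexFan_kappa_corner_le hUA hU₁ hU.1 htp.2 (ht₁.trans (htp.1.trans htp.2))]) le_rfl
  have h₂ : max ((U * t'A - UA * tp) / (U - UA) - 2 * tp) 0 ≤ max ((U₂ * t'A - UA * t₁) / (U₂ - UA) - 2 * t₁) 0 :=
    max_le_max (apexFan_kappa_sub_corner_le hUA (by linarith [hU.1]) hU.2 htp.1 ht₁) le_rfl
  have hm₁ : 0 ≤ max (2 * σ - (U * t'A - UA * tp) / (U - UA)) 0 := le_max_right _ _
  have e₁ : max (2 * σ - (U * t'A - UA * tp) / (U - UA)) 0 * A / 4 ≤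
      max (2 * σ - (U₁ * t'A - UA * t₂) / (U₁ - UA)) 0 * a / 4 :=
    div_le_div_of_nonneg_right ((mul_le_mul_of_nonneg_left ha hm₁).trans (mul_le_mul_of_nonneg_right h₁ ha0)) (by norm_num)
  have e₂ : max ((U * t'A - UA * tp) / (U - UA) - 2 * tp) 0 * 1.6211390 / 4 ≤
      max ((U₂ * t'A - UA * t₁) / (U₂ - UA) - 2 * t₁) 0 * 1.6211390 / 4 :=
    div_le_div_of_nonneg_right (mul_le_mul_of_nonneg_right h₂ (by norm_num)) (by norm_num)
  linarith

end SlotTwoSided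

end Summit.Ventures.CertifiedManyBodySolver.Observables

end
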